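import Summits.AnomalousDissipation.AnomalousDissipation.Theorems.SawtoothPulseCascadeK1LocalisedCascadeLedgerGlue

/-!
# K1loc, line `Spectral` / SeqCone — helper: THE CHEAP INPUTS OF THE LEDGER STEP, V HALF-SLOT (S-C glue, twin file)

Helper file of the prover lane on the crux `K1LocalisedCascade` (stmt-AnomalousDissipation-19491), route
`SawtoothPulseCascade`; the V-half-slot twin of `…K1LocalisedCascadeLedgerGlue` (split off for the 400-line limit):
`ledger_step_V_of_moduli` = `…K1Ledger.ledger_step_V` with the keep-form input commutators (first order,
`sqrt_tsum_symbol_sq_mul_le_keep_first_order`), the family cross term (`…SpectralCommutator.norm_tsum_symbol_sq_cross_le`)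
and the zone re-admission (`…ZoneReadmit.tsum_symbol_sq_le_readmit` + carriers) discharged from first-order symbol moduli,
`ℓ¹` spectral moments of the (unmodulated) cut-offs, the zone/layer volumes and the sup bound `|w(0)| ≤ B`; all `L²` norms
majorised by `‖w(0)‖`.  After this, one analytic input per family remains for the V half-slot of the ledger: `hfib^±`.
No definitions; no statement about the stub.
[cite: Grafakos2014, Prop. 3.1.2 (5) and Prop. 3.2.7 (3)] [cite: JohanssonSorella2024, Lemma 2.2 (maximum principle /
L² contraction)] [problem: turb]
-/

-- `Summit.<Summit>.<Problem>`: single-conjunct summit, the duplicate namespace segment is deliberate.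
set_option linter.dupNamespace false

noncomputable section

namespace Summit.AnomalousDissipation.AnomalousDissipation.Theorems.SawtoothPulseCascade.K1Ledger

open MeasureTheory Set Filter Topology UnitAddTorus Function Complex
open scoped ComplexConjugate
open Literature.Analysis Literature.Analysis.FunctionSpaces Literature.Analysis.FunctionSpaces.Torus
open Literature.Analysis.FluidPDE.ShearStage
open Literature.Analysis.FluidPDE.SawtoothCascade Literature.Analysis.FluidPDE.SawtoothCascade.CascadeParams
open Summit.AnomalousDissipation.AnomalousDissipation.Theorems.SawtoothPulseCascade.SpectralLeakage
open Summit.AnomalousDissipation.AnomalousDissipation.Theorems.SawtoothPulseCascade.K1Slot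

section Cascade

variable (P : CascadeParams)

/-- **The ledger step across the V half-slot of phase `j`, cheap inputs discharged** (indices swapped: cut-offs read `x₀`,
fibres `k₁ = n`, `Φ = shearMap 1 0 (amp U_j γ)`, `t₀ = tStart (j + 1)`, `t₁ = tStart (j+1)`).  As `ledger_step_V`, with the
keep-form input commutators, the family cross term and the zone re-admission supplied from FIRST-ORDER data: a modulus `ω`
of the old symbol `μ` and a modulus `ω₂` of the square of the new symbol `m`, the `ℓ¹` spectral moments
`E_σ = Σ ω|𝓕X̃^σ|`, `c = Σ ω₂|𝓕X⁺|`, `z = Σ ω₂|𝓕(X⁺+X⁻)|` (as summable families on `ℤ²`), disjoint families `X⁺X⁻ = 0`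
with `0 ≤ X⁺+X⁻ ≤ 1`, `|X⁻| ≤ 1`, and a sup bound `|w(0)| ≤ B` (propagated by the maximum principle).  Then, with
`t₀ = tStart (j + 1)`, `t₁ = tStart (j+1)`, `W₀ = ‖w(0)‖²`, `e_σ = E_slot + A_σ + √(2C_σ)` as in `ledger_step_V` and
`θ(x) = (X⁺+X⁻)(x₀)`:
`Σ m²|𝓕(w t₁)|² ≤ (√Σ μ²|𝓕(w t₀)|² + (√(E₊²+E₋²) + √(e₊²+e₋²))·√W₀)² + 2c·W₀ +
  (M²B²·vol{θ ≠ 1} + 2(z·W₀ + M²√W₀·(B/4)·√vol{θ ≠ 0 ∧ θ ≠ 1}))`.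
[cite: Grafakos2014, Prop. 3.1.2 (5) and Prop. 3.2.7 (3)] [cite: JohanssonSorella2024, Lemma 2.2] -/
theorem ledger_step_V_of_moduli (hγ : 0 ≤ P.γ) (hδ₀ : 0 < P.δ₀) (hd : 0 < P.d) (j : ℕ)
    (Q : ShearProfile) (hQ : ∀ y, Q y = deriv (P.U j) y)
    (Xsp Xspd Xp Xsm Xsmd Xm Z : ShearProfile) (hXspd : ∀ y, Xspd y = deriv Xsp y) (hXsmd : ∀ y, Xsmd y = deriv Xsm y)
    {κ ε₁ C₁ C₂ : ℝ} (hκ : 0 ≤ κ) (hε₁ : 0 ≤ ε₁) (hγε : P.γ * ε₁ ≤ 1)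
    (hXsp1 : ∀ y, |Xsp y| ≤ 1) (hXsm1 : ∀ y, |Xsm y| ≤ 1) (hpart : ∀ y, Xsp y ^ 2 + Xsm y ^ 2 ≤ 1)
    (hC₁p : ∀ y, |Xspd y| ≤ C₁) (hC₁m : ∀ y, |Xsmd y| ≤ C₁)
    (hC₂p : ∀ y, |deriv Xspd y| ≤ C₂) (hC₂m : ∀ y, |deriv Xsmd y| ≤ C₂)
    (hflat_p : ∀ y, Xsp y ≠ 0 ∨ Xspd y ≠ 0 → |Q y - 1| ≤ ε₁)
    (hflat_m : ∀ y, Xsm y ≠ 0 ∨ Xsmd y ≠ 0 → |Q y - (-1)| ≤ ε₁)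
    (hXXs_p : ∀ y, Xp y * Xsp y = Xp y) (hXXs_m : ∀ y, Xm y * Xsm y = Xm y) (hZ : ∀ y, Z y = 0)
    (hXpm : ∀ y, Xp y * Xm y = 0) (hXm1 : ∀ y, |Xm y| ≤ 1) (hX01 : ∀ y, 0 ≤ Xp y + Xm y ∧ Xp y + Xm y ≤ 1)
    {w : ℝ → UnitAddTorus (Fin 2) → ℝ} (hw : FluidPDE.Torus.IsClassicalScalarTransportOn (Ico 0 1) κ P.field w)
    {B : ℝ} (hB : ∀ x, |w 0 x| ≤ B)
    {μ m : (Fin 2 → ℤ) → ℝ} (hμ1 : ∀ k, |μ k| ≤ 1) {M : ℝ} (hmM : ∀ k, |m k| ≤ M)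
    {Ap Cp Am Cm : ℝ} (hAp : 0 ≤ Ap) (hCp : 0 ≤ Cp) (hAm : 0 ≤ Am) (hCm : 0 ≤ Cm)
    (hfib_p : ∀ n : ℤ, ∀ G : UnitAddTorus (Fin 2) → ℂ, IsSmooth G → (∀ k, mFourierCoeff G k ≠ 0 → k 1 = n) →
      ∑' k, m k ^ 2 * ‖mFourierCoeff (fun x => ((Xp.onCircle (x 0) : ℂ) + Z.onCircle (x 0)) *
          G (shearMap 1 0 (amp ⟨P.U j, P.U_periodic j, P.contDiff_U (P.δ_pos hδ₀ hd j)⟩ P.γ) x)) k‖ ^ 2 ≤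
        (Real.sqrt (∑' k, μ k ^ 2 * ‖mFourierCoeff G k‖ ^ 2) + Ap * Real.sqrt (∫ x, ‖G x‖ ^ 2)) ^ 2 +
          2 * Cp * ∫ x, ‖G x‖ ^ 2)
    (hfib_m : ∀ n : ℤ, ∀ G : UnitAddTorus (Fin 2) → ℂ, IsSmooth G → (∀ k, mFourierCoeff G k ≠ 0 → k 1 = n) →
      ∑' k, m k ^ 2 * ‖mFourierCoeff (fun x => ((Xm.onCircle (x 0) : ℂ) + Z.onCircle (x 0)) *
          G (shearMap 1 0 (amp ⟨P.U j, P.U_periodic j, P.contDiff_U (P.δ_pos hδ₀ hd j)⟩ P.γ) x)) k‖ ^ 2 ≤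
        (Real.sqrt (∑' k, μ k ^ 2 * ‖mFourierCoeff G k‖ ^ 2) + Am * Real.sqrt (∫ x, ‖G x‖ ^ 2)) ^ 2 +
          2 * Cm * ∫ x, ‖G x‖ ^ 2)
    {ω ω₂ : (Fin 2 → ℤ) → ℝ} (hω0 : ∀ q, 0 ≤ ω q) (hω : ∀ k q, |μ k - μ (k - q)| ≤ ω q)
    (hω20 : ∀ q, 0 ≤ ω₂ q) (hω2 : ∀ k q, |m k ^ 2 - m (k - q) ^ 2| ≤ ω₂ q)
    (hωp : Summable fun q => ω q * ‖mFourierCoeff (fun x : UnitAddTorus (Fin 2) => (Xsp.onCircle (x 0) : ℂ)) q‖)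
    (hωm : Summable fun q => ω q * ‖mFourierCoeff (fun x : UnitAddTorus (Fin 2) => (Xsm.onCircle (x 0) : ℂ)) q‖)
    (hω2p : Summable fun q => ω₂ q * ‖mFourierCoeff (fun x : UnitAddTorus (Fin 2) => (Xp.onCircle (x 0) : ℂ)) q‖)
    (hω2s : Summable fun q => ω₂ q *
      ‖mFourierCoeff (fun x : UnitAddTorus (Fin 2) => ((Xp.onCircle (x 0) + Xm.onCircle (x 0) : ℝ) : ℂ)) q‖) :
    ∑' k, m k ^ 2 * ‖mFourierCoeff (fun x => (w (tStart (j + 1)) x : ℂ)) k‖ ^ 2 ≤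
      (Real.sqrt (∑' k, μ k ^ 2 * ‖mFourierCoeff (fun x => (w (tStart j + tHalf j) x : ℂ)) k‖ ^ 2) +
          (Real.sqrt ((∑' q, ω q * ‖mFourierCoeff (fun x : UnitAddTorus (Fin 2) => (Xsp.onCircle (x 0) : ℂ)) q‖) ^ 2 +
                (∑' q, ω q * ‖mFourierCoeff (fun x : UnitAddTorus (Fin 2) => (Xsm.onCircle (x 0) : ℂ)) q‖) ^ 2) +
              Real.sqrt ((2 * κ * tHalf j * C₂ + 4 * C₁ * Real.sqrt (κ * tHalf j / 2) +
                    Real.sqrt (P.γ * ε₁ * (5 + 6 * C₁ ^ 2 * κ * tHalf j)) + Ap + Real.sqrt (2 * Cp)) ^ 2 +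
                (2 * κ * tHalf j * C₂ + 4 * C₁ * Real.sqrt (κ * tHalf j / 2) +
                    Real.sqrt (P.γ * ε₁ * (5 + 6 * C₁ ^ 2 * κ * tHalf j)) + Am + Real.sqrt (2 * Cm)) ^ 2)) *
            Real.sqrt (FluidPDE.Torus.scalarL2Sq (w 0))) ^ 2 +
        2 * ((∑' q, ω₂ q * ‖mFourierCoeff (fun x : UnitAddTorus (Fin 2) => (Xp.onCircle (x 0) : ℂ)) q‖) *
          FluidPDE.Torus.scalarL2Sq (w 0)) +
        (M ^ 2 * (B ^ 2 * volume.real {x : UnitAddTorus (Fin 2) | Xp.onCircle (x 0) + Xm.onCircle (x 0) ≠ 1}) +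
          2 * ((∑' q, ω₂ q *
              ‖mFourierCoeff (fun x : UnitAddTorus (Fin 2) => ((Xp.onCircle (x 0) + Xm.onCircle (x 0) : ℝ) : ℂ)) q‖) *
                FluidPDE.Torus.scalarL2Sq (w 0) +
            M ^ 2 * Real.sqrt (FluidPDE.Torus.scalarL2Sq (w 0)) *
              ((B / 4) * Real.sqrt (volume.real {x : UnitAddTorus (Fin 2) |
                Xp.onCircle (x 0) + Xm.onCircle (x 0) ≠ 0 ∧ Xp.onCircle (x 0) + Xm.onCircle (x 0) ≠ 1})))) := by
  set t₀ : ℝ := tStart j + tHalf j with ht₀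
  set t₁ : ℝ := tStart (j + 1) with ht₁
  have htH := tHalf_pos j
  have ht₀mem : t₀ ∈ Ico (0 : ℝ) 1 := ⟨by rw [ht₀]; linarith [tStart_nonneg j], tStart_add_tHalf_lt_one j⟩
  have ht₁mem : t₁ ∈ Ico (0 : ℝ) 1 := ⟨tStart_nonneg (j + 1), tStart_lt_one (j + 1)⟩
  have hw₀ : IsSmooth (w t₀) := hw.smooth_scalar.isSmooth_slice ht₀mem
  have hw₁ : IsSmooth (w t₁) := hw.smooth_scalar.isSmooth_slice ht₁mem
  have hM0 : 0 ≤ M := (abs_nonneg _).trans (hmM 0)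
  have hB0 : 0 ≤ B := (abs_nonneg _).trans (hB 0)
  -- `L²` decay and the maximum principle
  have hL2₁ : FluidPDE.Torus.scalarL2Sq (w t₁) ≤ FluidPDE.Torus.scalarL2Sq (w 0) := by
    have hS : Icc 0 t₁ ⊆ Ico (0 : ℝ) 1 := fun s hs => ⟨hs.1, hs.2.trans_lt ht₁mem.2⟩
    exact hw.antitoneOn_scalarL2Sq hκ hS (left_mem_Icc.2 ht₁mem.1) (right_mem_Icc.2 ht₁mem.1) ht₁mem.1
  have hL2₀ : FluidPDE.Torus.scalarL2Sq (w t₀) ≤ FluidPDE.Torus.scalarL2Sq (w 0) := by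
    have hS : Icc 0 t₀ ⊆ Ico (0 : ℝ) 1 := fun s hs => ⟨hs.1, hs.2.trans_lt ht₀mem.2⟩
    exact hw.antitoneOn_scalarL2Sq hκ hS (left_mem_Icc.2 ht₀mem.1) (right_mem_Icc.2 ht₀mem.1) ht₀mem.1
  have hsup₁ : ∀ x, |w t₁ x| ≤ B := fun x =>
    hw.abs_le_of_forall_abs_init_le hκ (a := 0) (b := t₁) (fun s hs => ⟨hs.1, hs.2.trans_lt ht₁mem.2⟩) hB
      (right_mem_Icc.2 ht₁mem.1) x
  -- the complex slices and cut-offs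
  set F₀ : UnitAddTorus (Fin 2) → ℂ := fun x => (w t₀ x : ℂ) with hF₀
  set F₁ : UnitAddTorus (Fin 2) → ℂ := fun x => (w t₁ x : ℂ) with hF₁
  have hF₀c : Continuous F₀ := continuous_ofReal.comp hw₀.continuous
  have hF₁c : Continuous F₁ := continuous_ofReal.comp hw₁.continuous
  have hF₀s : Summable fun k => ‖mFourierCoeff F₀ k‖ := hw₀.ofReal_comp.rapidDecay_mFourierCoeff.summable_norm
  have hF₁s : Summable fun k => ‖mFourierCoeff F₁ k‖ := hw₁.ofReal_comp.rapidDecay_mFourierCoeff.summable_norm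
  have hF₀L2 : ∫ x, ‖F₀ x‖ ^ 2 = FluidPDE.Torus.scalarL2Sq (w t₀) := by
    unfold FluidPDE.Torus.scalarL2Sq
    refine integral_congr_ae (ae_of_all _ fun x => ?_)
    simp only [hF₀, Complex.norm_real, Real.norm_eq_abs, sq_abs]
  have hF₁L2 : ∫ x, ‖F₁ x‖ ^ 2 = FluidPDE.Torus.scalarL2Sq (w t₁) := by
    unfold FluidPDE.Torus.scalarL2Sq
    refine integral_congr_ae (ae_of_all _ fun x => ?_)
    simp only [hF₁, Complex.norm_real, Real.norm_eq_abs, sq_abs]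
  have hsm : ∀ X : ShearProfile, IsSmooth (fun x : UnitAddTorus (Fin 2) => (X.onCircle (x 0) : ℂ)) := fun X =>
    (isSmooth_onCircle_comp' X 0).ofReal_comp
  have habs : ∀ (X : ShearProfile) (C : ℝ), (∀ y, |X y| ≤ C) → ∀ x : UnitAddTorus (Fin 2), ‖(X.onCircle (x 0) : ℂ)‖ ≤ C :=
    fun X C hC x => by
      obtain ⟨y, hy⟩ := QuotientAddGroup.mk_surjective (x 0)
      rw [← hy, ShearProfile.onCircle_coe, Complex.norm_real, Real.norm_eq_abs]; exact hC y
  -- (a) the keep-form input commutators, first order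
  have hcp := sqrt_tsum_symbol_sq_mul_le_keep_first_order hF₀c hF₀s (hsm Xsp).continuous
    (hsm Xsp).rapidDecay_mFourierCoeff.summable_norm (habs Xsp 1 hXsp1) hμ1 hω0 hω hωp
  have hcm := sqrt_tsum_symbol_sq_mul_le_keep_first_order hF₀c hF₀s (hsm Xsm).continuous
    (hsm Xsm).rapidDecay_mFourierCoeff.summable_norm (habs Xsm 1 hXsm1) hμ1 hω0 hω hωm
  -- (b) the family cross term (disjoint families)
  have hdis : ∀ x : UnitAddTorus (Fin 2), conj (Xp.onCircle (x 0) : ℂ) * (Xm.onCircle (x 0) : ℂ) = 0 := fun x => by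
    obtain ⟨y, hy⟩ := QuotientAddGroup.mk_surjective (x 0)
    rw [← hy, ShearProfile.onCircle_coe, ShearProfile.onCircle_coe, Complex.conj_ofReal, ← Complex.ofReal_mul, hXpm,
      Complex.ofReal_zero]
  have hcross0 := norm_tsum_symbol_sq_cross_le hF₁c hF₁s (hsm Xp).continuous
    (hsm Xp).rapidDecay_mFourierCoeff.summable_norm (hsm Xm).continuous (habs Xm 1 hXm1) hdis hmM hω20 hω2 hω2p
  have hPf : (fun x : UnitAddTorus (Fin 2) => (Xp.onCircle (x 0) : ℂ) * F₁ x) =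
      fun x => ((Xp.onCircle (x 0) * w t₁ x : ℝ) : ℂ) := by
    funext x; simp only [hF₁, Complex.ofReal_mul]
  have hQf : (fun x : UnitAddTorus (Fin 2) => (Xm.onCircle (x 0) : ℂ) * F₁ x) =
      fun x => ((Xm.onCircle (x 0) * w t₁ x : ℝ) : ℂ) := by
    funext x; simp only [hF₁, Complex.ofReal_mul]
  rw [hPf, hQf, hF₁L2] at hcross0
  have hcross : ‖∑' k, ((m k ^ 2 : ℝ) : ℂ) *
        mFourierCoeff (fun x => ((Xp.onCircle (x 0) * w t₁ x : ℝ) : ℂ)) k *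
          conj (mFourierCoeff (fun x => ((Xm.onCircle (x 0) * w t₁ x : ℝ) : ℂ)) k)‖ ≤
      (∑' q, ω₂ q * ‖mFourierCoeff (fun x : UnitAddTorus (Fin 2) => (Xp.onCircle (x 0) : ℂ)) q‖) *
        FluidPDE.Torus.scalarL2Sq (w 0) :=
    hcross0.trans (mul_le_mul_of_nonneg_left hL2₁ (tsum_nonneg fun q => mul_nonneg (hω20 q) (norm_nonneg _)))
  -- (c) the zone re-admission
  have hΘsm : IsSmooth (fun x : UnitAddTorus (Fin 2) => ((Xp.onCircle (x 0) + Xm.onCircle (x 0) : ℝ) : ℂ)) :=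
    ((isSmooth_onCircle_comp' Xp 0).add (isSmooth_onCircle_comp' Xm 0)).ofReal_comp
  have hθc : Continuous (fun x : UnitAddTorus (Fin 2) => Xp.onCircle (x 0) + Xm.onCircle (x 0)) :=
    (isSmooth_onCircle_comp' Xp 0).continuous.add (isSmooth_onCircle_comp' Xm 0).continuous
  have hθ01 : ∀ x : UnitAddTorus (Fin 2), 0 ≤ Xp.onCircle (x 0) + Xm.onCircle (x 0) ∧
      Xp.onCircle (x 0) + Xm.onCircle (x 0) ≤ 1 := fun x => by
    obtain ⟨y, hy⟩ := QuotientAddGroup.mk_surjective (x 0)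
    rw [← hy, ShearProfile.onCircle_coe, ShearProfile.onCircle_coe]; exact hX01 y
  have hΘ1' : ∀ x : UnitAddTorus (Fin 2), ‖1 - (((Xp.onCircle (x 0) + Xm.onCircle (x 0) : ℝ) : ℂ))‖ ≤ 1 := fun x => by
    rw [← Complex.ofReal_one, ← Complex.ofReal_sub, Complex.norm_real, Real.norm_eq_abs]
    have := hθ01 x
    rw [abs_le]; constructor <;> linarith
  have hθ1abs : ∀ x : UnitAddTorus (Fin 2), |1 - (Xp.onCircle (x 0) + Xm.onCircle (x 0))| ≤ 1 := fun x => by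
    have := hθ01 x
    rw [abs_le]; constructor <;> linarith
  have hF₁B : ∀ x, ‖F₁ x‖ ≤ B := fun x => by
    simp only [hF₁, Complex.norm_real, Real.norm_eq_abs]; exact hsup₁ x
  have hread := tsum_symbol_sq_le_readmit hF₁c hF₁s hΘsm.continuous hΘsm.rapidDecay_mFourierCoeff.summable_norm hΘ1'
    hmM hω20 hω2 hω2s
  have hzone1 := integral_norm_sq_one_sub_mul_le hF₁c hθc hθ1abs hF₁B
  have hzone2 := integral_norm_sq_overlap_le hF₁c hθc (fun x => (hθ01 x).1) (fun x => (hθ01 x).2) hF₁B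
  -- rewrite the re-admission in the cut-off form
  have hΘF : (fun x : UnitAddTorus (Fin 2) => (((Xp.onCircle (x 0) + Xm.onCircle (x 0) : ℝ) : ℂ)) * F₁ x) =
      fun x => (((Xp.onCircle (x 0) + Xm.onCircle (x 0)) * w t₁ x : ℝ) : ℂ) := by
    funext x; simp only [hF₁]; push_cast; ring
  rw [hΘF, hF₁L2] at hread
  -- assemble the zone constant
  have hsq2 : Real.sqrt (∫ x : UnitAddTorus (Fin 2), ‖((Xp.onCircle (x 0) + Xm.onCircle (x 0) : ℝ) : ℂ) *
        (1 - ((Xp.onCircle (x 0) + Xm.onCircle (x 0) : ℝ) : ℂ)) * F₁ x‖ ^ 2) ≤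
      (B / 4) * Real.sqrt (volume.real {x : UnitAddTorus (Fin 2) |
        Xp.onCircle (x 0) + Xm.onCircle (x 0) ≠ 0 ∧ Xp.onCircle (x 0) + Xm.onCircle (x 0) ≠ 1}) := by
    refine (Real.sqrt_le_sqrt hzone2).trans (le_of_eq ?_)
    rw [Real.sqrt_mul (sq_nonneg _), Real.sqrt_sq (by positivity)]
  have hz0 : 0 ≤ ∑' q, ω₂ q *
      ‖mFourierCoeff (fun x : UnitAddTorus (Fin 2) => ((Xp.onCircle (x 0) + Xm.onCircle (x 0) : ℝ) : ℂ)) q‖ :=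
    tsum_nonneg fun q => mul_nonneg (hω20 q) (norm_nonneg _)
  have hzone : ∑' k, m k ^ 2 * ‖mFourierCoeff (fun x => (w t₁ x : ℂ)) k‖ ^ 2 ≤
      ∑' k, m k ^ 2 * ‖mFourierCoeff (fun x => (((Xp.onCircle (x 0) + Xm.onCircle (x 0)) * w t₁ x : ℝ) : ℂ)) k‖ ^ 2 +
        (M ^ 2 * (B ^ 2 * volume.real {x : UnitAddTorus (Fin 2) | Xp.onCircle (x 0) + Xm.onCircle (x 0) ≠ 1}) +
          2 * ((∑' q, ω₂ q *
              ‖mFourierCoeff (fun x : UnitAddTorus (Fin 2) => ((Xp.onCircle (x 0) + Xm.onCircle (x 0) : ℝ) : ℂ)) q‖) *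
                FluidPDE.Torus.scalarL2Sq (w 0) +
            M ^ 2 * Real.sqrt (FluidPDE.Torus.scalarL2Sq (w 0)) *
              ((B / 4) * Real.sqrt (volume.real {x : UnitAddTorus (Fin 2) |
                Xp.onCircle (x 0) + Xm.onCircle (x 0) ≠ 0 ∧ Xp.onCircle (x 0) + Xm.onCircle (x 0) ≠ 1})))) := by
    have h1 := mul_le_mul_of_nonneg_left hzone1 (sq_nonneg M)
    have h2 := mul_le_mul_of_nonneg_left hL2₁ hz0
    have h3 : M ^ 2 * Real.sqrt (FluidPDE.Torus.scalarL2Sq (w t₁)) *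
          Real.sqrt (∫ x : UnitAddTorus (Fin 2), ‖((Xp.onCircle (x 0) + Xm.onCircle (x 0) : ℝ) : ℂ) *
            (1 - ((Xp.onCircle (x 0) + Xm.onCircle (x 0) : ℝ) : ℂ)) * F₁ x‖ ^ 2) ≤
        M ^ 2 * Real.sqrt (FluidPDE.Torus.scalarL2Sq (w 0)) *
          ((B / 4) * Real.sqrt (volume.real {x : UnitAddTorus (Fin 2) |
            Xp.onCircle (x 0) + Xm.onCircle (x 0) ≠ 0 ∧ Xp.onCircle (x 0) + Xm.onCircle (x 0) ≠ 1})) :=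
      mul_le_mul (mul_le_mul_of_nonneg_left (Real.sqrt_le_sqrt hL2₁) (sq_nonneg _)) hsq2 (Real.sqrt_nonneg _)
        (by positivity)
    have h := hread
    simp only [hF₁] at h h1 h3 ⊢
    linarith [h, h1, h2, h3]
  -- (d) the ledger step with these inputs, then `‖w t₀‖ ≤ ‖w 0‖`
  have hEp0 : 0 ≤ ∑' q, ω q * ‖mFourierCoeff (fun x : UnitAddTorus (Fin 2) => (Xsp.onCircle (x 0) : ℂ)) q‖ :=
    tsum_nonneg fun q => mul_nonneg (hω0 q) (norm_nonneg _)
  have hEm0 : 0 ≤ ∑' q, ω q * ‖mFourierCoeff (fun x : UnitAddTorus (Fin 2) => (Xsm.onCircle (x 0) : ℂ)) q‖ :=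
    tsum_nonneg fun q => mul_nonneg (hω0 q) (norm_nonneg _)
  have hstep := ledger_step_V P hγ hδ₀ hd j Q hQ Xsp Xspd Xp Xsm Xsmd Xm Z hXspd hXsmd hκ hε₁ hγε hXsp1 hXsm1 hpart
    hC₁p hC₁m hC₂p hC₂m hflat_p hflat_m hXXs_p hXXs_m hZ hw hμ1 hmM hAp hCp hAm hCm hfib_p hfib_m hEp0 hEm0 hcp hcm
    hcross hzone
  refine hstep.trans ?_
  -- monotonicity in the `L²` factor
  have hI0 : 0 ≤ Real.sqrt (∑' k, μ k ^ 2 * ‖mFourierCoeff (fun x => (w t₀ x : ℂ)) k‖ ^ 2) := Real.sqrt_nonneg _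
  have hc0 : 0 ≤ Real.sqrt ((∑' q, ω q * ‖mFourierCoeff (fun x : UnitAddTorus (Fin 2) => (Xsp.onCircle (x 0) : ℂ)) q‖) ^ 2 +
        (∑' q, ω q * ‖mFourierCoeff (fun x : UnitAddTorus (Fin 2) => (Xsm.onCircle (x 0) : ℂ)) q‖) ^ 2) +
      Real.sqrt ((2 * κ * tHalf j * C₂ + 4 * C₁ * Real.sqrt (κ * tHalf j / 2) +
            Real.sqrt (P.γ * ε₁ * (5 + 6 * C₁ ^ 2 * κ * tHalf j)) + Ap + Real.sqrt (2 * Cp)) ^ 2 +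
          (2 * κ * tHalf j * C₂ + 4 * C₁ * Real.sqrt (κ * tHalf j / 2) +
            Real.sqrt (P.γ * ε₁ * (5 + 6 * C₁ ^ 2 * κ * tHalf j)) + Am + Real.sqrt (2 * Cm)) ^ 2) := by positivity
  have hW : Real.sqrt (FluidPDE.Torus.scalarL2Sq (w t₀)) ≤ Real.sqrt (FluidPDE.Torus.scalarL2Sq (w 0)) :=
    Real.sqrt_le_sqrt hL2₀
  have hbase := mul_le_mul_of_nonneg_left hW hc0
  have hsq := pow_le_pow_left₀ (by positivity) (add_le_add_left hbase
    (Real.sqrt (∑' k, μ k ^ 2 * ‖mFourierCoeff (fun x => (w t₀ x : ℂ)) k‖ ^ 2))) 2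
  simp only [hF₀] at hsq hstep ⊢
  linarith [hsq]

end Cascade

end Summit.AnomalousDissipation.AnomalousDissipation.Theorems.SawtoothPulseCascade.K1Ledger
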